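import Mathlib.Analysis.Fourier.AddCircle
import Mathlib.MeasureTheory.Measure.HasOuterApproxClosed
import Mathlib.MeasureTheory.Integral.IntervalIntegral.Periodic
import Mathlib.MeasureTheory.Integral.DominatedConvergence
import Mathlib.MeasureTheory.Integral.BoundedContinuousFunction
import Mathlib.Analysis.Calculus.SmoothSeries
import Mathlib.Analysis.Calculus.IteratedDeriv.Defs
import Mathlib.Analysis.SpecialFunctions.Trigonometric.Bounds
import HarnessLib

/-!
# Fourier inversion for laws on the circle, and absolutely convergent trigonometric series

First support file of the provefact unit for `AjankiHuveneers2011_approxKernels` (Lemma 5.2,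
eqs. (5.9)–(5.10) of O. Ajanki, F. Huveneers, CMP **301** (2011) 841–883, arXiv:1003.1076; the
fact is vendored in `DisorderedHarmonicChainPotential.lean`). The proof of Lemma 5.2 (Appendix 7.3
of the paper) writes `S_{y,n}u(x) = 𝔼 u(x + Z_n)` for a sum `Z_n` of independent phase increments
and expands in Fourier series on `𝕋 = ℝ/ℤ`: "`S_{y,n}u(x) = ∑_ξ e^{i2πξ(x+nw-y)} Λ_n(ξ) v̂(ξ)`,
... the right hand side represents actually a `C²`-function". Since the lemma is a POINTWISE
statement for every `x ∈ 𝕋` and `u` is only a bounded Borel representative, the identity must hold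
everywhere, not almost everywhere; this file supplies exactly that, from Mathlib:

* `integral_eq_of_summable_fourierCoeff`: a finite Borel measure `ν` on `UnitAddCircle` whose
  Fourier–Stieltjes coefficients `c(n) = ∫ e_{-n} dν` are absolutely summable satisfies
  `∫ g dν = ∫ g · Re(∑ c(n) e_n) dz` for every bounded Borel `g` (so `ν ≪ dz` with a continuous
  density). Proof: both sides are continuous linear functionals on `C(𝕋, ℂ)` agreeing on
  characters (`fourierCoeff_fourier`), hence on all of `C(𝕋, ℂ)` (`span_fourier_closure_eq_top`);
  splitting `Re ρ = ρ⁺ - ρ⁻` into two `withDensity` measures, `ν + ρ⁻dz = ρ⁺dz` by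
  `ext_of_forall_integral_eq_of_IsFiniteMeasure`, which then integrates Borel functions.
* `integral_comp_add_eq_re_tsum`: for a real random variable `Z` on a finite measure space with
  `d(n) = 𝔼 e^{2πinZ}` absolutely summable, `𝔼 u(x + Z) = Re ∑ₙ d(n) û(n) e^{2πinx}` for every
  bounded Borel `1`-periodic `u` and EVERY `x`, `û(n) = ∫₀¹ u e^{-2πins}` (`circleCoeff`); with the
  bounds `|û(n)| ≤ ‖u‖₁`, `|v̂(n+1) - v̂(n)| ≤ 2πr‖v‖₁`, `|v̂(n+2) - 2v̂(n+1) + v̂(n)| ≤ (2πr)²‖v‖₁`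
  for `v` supported in `B(0,r) + ℤ` (the estimate "`|v̂(ξ) - v̂(ξ-1)| ≲ w²‖u‖₁`" of App. 7.3).
* `trigSeries a θ = ∑_ξ a(ξ) e^{2πiξθ}`: continuity, two termwise derivatives
  (`hasDerivAt_tsum`), `C²` regularity of `x ↦ Re F_a(x + c₀)`, and the `sin`-weight identities
  `sin(πθ) F_a = (e^{iπθ}/2i) F_{-Δa}`, giving `|sin(πθ) F_a(θ)| ≤ ½ ∑|Δa|` and
  `|sin²(πθ) F_a(θ)| ≤ ¼ ∑|Δ²a|` (`Δa(ξ) = a(ξ+1) - a(ξ)`), which is how the weights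
  `sinᵏ π(x + wn - y)` of (5.10) are converted into differences of the multipliers.

All statements here are standard harmonic analysis ([folklore]; e.g. Katznelson, *An introduction
to harmonic analysis*, I.7 for measures with absolutely summable Fourier–Stieltjes series); nothing
specific to the harmonic chain is used, and nothing here is a named fact.
-/

noncomputable section

open MeasureTheory Complex Filter Topology Set Real

namespace Literature.Barriers.AtomisticToContinuum.HeatConduction

section Circle

/-- The candidate density `ρ(z) = ∑ₙ c(n) e_n(z)` attached to a summable sequence of Fourier
coefficients on the unit circle. [folklore] -/
def fourierDensity (c : ℤ → ℂ) (z : UnitAddCircle) : ℂ := ∑' n, c n * fourier n z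

variable {c : ℤ → ℂ}

/-- Each term of the density series is bounded by `‖c n‖`. [folklore] -/
theorem norm_mul_fourier_le (c : ℤ → ℂ) (n : ℤ) (z : UnitAddCircle) :
    ‖c n * fourier n z‖ ≤ ‖c n‖ := by
  rw [norm_mul, fourier_apply, Circle.norm_coe, mul_one]

/-- The density series converges absolutely. [folklore] -/
theorem summable_fourierDensity (hc : Summable fun n => ‖c n‖) (z : UnitAddCircle) :
    Summable fun n => c n * fourier n z :=
  .of_norm_bounded hc (fun n => norm_mul_fourier_le c n z)

/-- The density is continuous. [folklore] -/
theorem continuous_fourierDensity (hc : Summable fun n => ‖c n‖) :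
    Continuous (fourierDensity c) := by
  unfold fourierDensity
  exact continuous_tsum (fun n => continuous_const.mul (fourier n).continuous) hc
    fun n z => norm_mul_fourier_le c n z

/-- The density is bounded by `∑ ‖c n‖`. [folklore] -/
theorem norm_fourierDensity_le (hc : Summable fun n => ‖c n‖) (z : UnitAddCircle) :
    ‖fourierDensity c z‖ ≤ ∑' n, ‖c n‖ :=
  tsum_of_norm_bounded hc.hasSum fun n => norm_mul_fourier_le c n z

/-- Orthogonality: `∫ e_m e_n = [m + n = 0]`. [folklore] -/
theorem integral_fourier_mul_fourier (m n : ℤ) :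
    ∫ z : UnitAddCircle, fourier m z * fourier n z ∂AddCircle.haarAddCircle =
      if n = -m then 1 else 0 := by
  have h := congr_fun (fourierCoeff_fourier (T := 1) n) (-m)
  rw [fourierCoeff, Pi.single_apply] at h
  simp only [neg_neg, smul_eq_mul] at h
  rw [h]
  congr 1
  exact propext eq_comm

/-- Pairing the density with a character recovers the coefficient: `∫ e_m ρ = c(-m)`. [folklore] -/
theorem integral_fourier_mul_fourierDensity (hc : Summable fun n => ‖c n‖) (m : ℤ) :
    ∫ z : UnitAddCircle, fourier m z * fourierDensity c z ∂AddCircle.haarAddCircle = c (-m) := by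
  have hint : ∀ n, Integrable (fun z : UnitAddCircle => fourier m z * (c n * fourier n z))
      AddCircle.haarAddCircle := fun n =>
    ((fourier m).continuous.mul (continuous_const.mul (fourier n).continuous)).integrable_of_hasCompactSupport
      (HasCompactSupport.of_compactSpace _)
  have hsum : Summable fun n => ∫ z : UnitAddCircle, ‖fourier m z * (c n * fourier n z)‖
      ∂AddCircle.haarAddCircle := by
    refine .of_nonneg_of_le (fun n => integral_nonneg fun z => norm_nonneg _) (fun n => ?_) hc
    have : ∫ z : UnitAddCircle, ‖fourier m z * (c n * fourier n z)‖ ∂AddCircle.haarAddCircle ≤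
        ∫ _z : UnitAddCircle, ‖c n‖ ∂AddCircle.haarAddCircle := by
      refine integral_mono_of_nonneg (ae_of_all _ fun z => norm_nonneg _) (integrable_const _)
        (ae_of_all _ fun z => ?_)
      simp only [norm_mul, fourier_apply, Circle.norm_coe, one_mul, mul_one, le_refl]
    simpa only [integral_const, smul_eq_mul, probReal_univ, one_mul] using this
  calc ∫ z : UnitAddCircle, fourier m z * fourierDensity c z ∂AddCircle.haarAddCircle
      = ∫ z : UnitAddCircle, ∑' n, fourier m z * (c n * fourier n z) ∂AddCircle.haarAddCircle := by
        refine integral_congr_ae (ae_of_all _ fun z => ?_)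
        simp only [fourierDensity]
        rw [tsum_mul_left]
    _ = ∑' n, ∫ z : UnitAddCircle, fourier m z * (c n * fourier n z) ∂AddCircle.haarAddCircle :=
        (integral_tsum_of_summable_integral_norm hint hsum).symm
    _ = ∑' n, c n * (if n = -m then 1 else 0) := by
        congr 1; funext n
        rw [show (fun z : UnitAddCircle => fourier m z * (c n * fourier n z)) =
          fun z => c n * (fourier m z * fourier n z) by funext z; ring, integral_const_mul,
          integral_fourier_mul_fourier]
    _ = c (-m) := by
        rw [tsum_eq_single (-m)]
        · simp
        · intro n hn; simp [hn]

/-- Continuous functions on the circle are integrable against finite measures. [folklore] -/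
theorem integrable_continuousMap (μ : Measure UnitAddCircle) [IsFiniteMeasure μ]
    (g : C(UnitAddCircle, ℂ)) : Integrable g μ :=
  g.continuous.integrable_of_hasCompactSupport (HasCompactSupport.of_compactSpace g)

/-- `g ↦ ∫ g F dμ` is continuous on `C(𝕋, ℂ)` for `F` bounded measurable and `μ` finite. [folklore] -/
theorem continuous_integral_continuousMap_mul (μ : Measure UnitAddCircle) [IsFiniteMeasure μ]
    {F : UnitAddCircle → ℂ} (hF : AEStronglyMeasurable F μ) {M : ℝ} (hM : ∀ z, ‖F z‖ ≤ M) :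
    Continuous fun g : C(UnitAddCircle, ℂ) => ∫ z, g z * F z ∂μ := by
  have hM0 : 0 ≤ M := (norm_nonneg _).trans (hM 0)
  have hint : ∀ g : C(UnitAddCircle, ℂ), Integrable (fun z => g z * F z) μ := fun g =>
    (integrable_continuousMap μ g).mul_bdd hF (ae_of_all _ hM)
  apply LipschitzWith.continuous (K := ⟨M * μ.real univ, by positivity⟩)
  apply LipschitzWith.of_dist_le_mul
  intro g g'
  rw [dist_eq_norm, dist_eq_norm, ← integral_sub (hint g) (hint g')]
  calc ‖∫ z, (g z * F z - g' z * F z) ∂μ‖ ≤ (‖g - g'‖ * M) * μ.real univ := by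
        refine norm_integral_le_of_norm_le_const (ae_of_all _ fun z => ?_)
        rw [← sub_mul, norm_mul]
        exact mul_le_mul ((g - g').norm_coe_le_norm z) (hM z) (norm_nonneg _) (norm_nonneg _)
    _ = (⟨M * μ.real univ, by positivity⟩ : NNReal) * ‖g - g'‖ := by
        push_cast; ring

variable {ν : Measure UnitAddCircle} [IsFiniteMeasure ν]

/-- **Step 1.** If the Fourier coefficients `∫ e_{-n} dν = c(n)` of a finite measure `ν` on the
circle are absolutely summable, then `∫ g dν = ∫ g ρ dz` for every continuous `g`, `ρ = ∑ c(n) e_n`: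
both sides are continuous linear functionals agreeing on characters, and trigonometric
polynomials are dense in `C(𝕋, ℂ)`. [folklore] -/
theorem integral_continuousMap_eq_of_fourierCoeff (hc : Summable fun n => ‖c n‖)
    (hν : ∀ n : ℤ, ∫ z, fourier (-n) z ∂ν = c n) (g : C(UnitAddCircle, ℂ)) :
    ∫ z, g z ∂ν = ∫ z, g z * fourierDensity c z ∂AddCircle.haarAddCircle := by
  have hρm : AEStronglyMeasurable (fourierDensity c) AddCircle.haarAddCircle :=
    (continuous_fourierDensity hc).aestronglyMeasurable
  have hint₂ : ∀ g : C(UnitAddCircle, ℂ), Integrable (fun z => g z * fourierDensity c z)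
      AddCircle.haarAddCircle := fun g =>
    (integrable_continuousMap _ g).mul_bdd hρm (ae_of_all _ (norm_fourierDensity_le hc))
  let L₁ : C(UnitAddCircle, ℂ) →ₗ[ℂ] ℂ :=
    { toFun := fun g => ∫ z, g z ∂ν
      map_add' := fun g g' => by
        simp only [ContinuousMap.coe_add, Pi.add_apply]
        exact integral_add (integrable_continuousMap ν g) (integrable_continuousMap ν g')
      map_smul' := fun a g => by
        simp only [ContinuousMap.coe_smul, Pi.smul_apply, smul_eq_mul, RingHom.id_apply]
        exact integral_const_mul a _ }
  let L₂ : C(UnitAddCircle, ℂ) →ₗ[ℂ] ℂ :=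
    { toFun := fun g => ∫ z, g z * fourierDensity c z ∂AddCircle.haarAddCircle
      map_add' := fun g g' => by
        simp only [ContinuousMap.coe_add, Pi.add_apply, add_mul]
        exact integral_add (hint₂ g) (hint₂ g')
      map_smul' := fun a g => by
        simp only [ContinuousMap.coe_smul, Pi.smul_apply, smul_eq_mul, RingHom.id_apply,
          mul_assoc]
        exact integral_const_mul a _ }
  have hL₁c : Continuous L₁ := by
    have := continuous_integral_continuousMap_mul ν (F := fun _ => (1 : ℂ))
      aestronglyMeasurable_const (M := 1) (fun z => by simp)
    simpa [L₁] using this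
  have hL₂c : Continuous L₂ :=
    continuous_integral_continuousMap_mul _ hρm (norm_fourierDensity_le hc)
  have h1 : Set.EqOn L₁ L₂ (Set.range (fourier (T := 1))) := by
    rintro _ ⟨m, rfl⟩
    show ∫ z, fourier m z ∂ν = ∫ z, fourier m z * fourierDensity c z ∂AddCircle.haarAddCircle
    rw [integral_fourier_mul_fourierDensity hc m, ← hν (-m), neg_neg]
  have h2 : Set.EqOn L₁ L₂ (Submodule.span ℂ (Set.range (fourier (T := 1))) :
      Set C(UnitAddCircle, ℂ)) := LinearMap.eqOn_span' h1
  have h3 := h2.closure hL₁c hL₂c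
  have h4 : closure (Submodule.span ℂ (Set.range (fourier (T := 1))) : Set C(UnitAddCircle, ℂ)) =
      Set.univ := by
    rw [← Submodule.topologicalClosure_coe, span_fourier_closure_eq_top]; rfl
  exact h3 (h4 ▸ Set.mem_univ g)

/-- The real part `ρᵣ = Re ρ` of the candidate density. [folklore] -/
def fourierDensityRe (c : ℤ → ℂ) (z : UnitAddCircle) : ℝ := (fourierDensity c z).re

/-- `ρᵣ` is continuous. [folklore] -/
theorem continuous_fourierDensityRe (hc : Summable fun n => ‖c n‖) :
    Continuous (fourierDensityRe c) :=
  Complex.continuous_re.comp (continuous_fourierDensity hc)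

/-- `|ρᵣ| ≤ ∑ |c(n)|`. [folklore] -/
theorem abs_fourierDensityRe_le (hc : Summable fun n => ‖c n‖) (z : UnitAddCircle) :
    |fourierDensityRe c z| ≤ ∑' n, ‖c n‖ :=
  (Complex.abs_re_le_norm _).trans (norm_fourierDensity_le hc z)

/-- **Step 2.** The same identity for real bounded continuous test functions, with the real part
of the density. [folklore] -/
theorem integral_bcf_eq_of_fourierCoeff (hc : Summable fun n => ‖c n‖)
    (hν : ∀ n : ℤ, ∫ z, fourier (-n) z ∂ν = c n) (g : BoundedContinuousFunction UnitAddCircle ℝ) :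
    ∫ z, g z ∂ν = ∫ z, g z * fourierDensityRe c z ∂AddCircle.haarAddCircle := by
  let gC : C(UnitAddCircle, ℂ) := ⟨fun z => (g z : ℂ), Complex.continuous_ofReal.comp g.continuous⟩
  have h := integral_continuousMap_eq_of_fourierCoeff hc hν gC
  have hint : Integrable (fun z => gC z * fourierDensity c z) AddCircle.haarAddCircle :=
    (integrable_continuousMap _ gC).mul_bdd (continuous_fourierDensity hc).aestronglyMeasurable
      (ae_of_all _ (norm_fourierDensity_le hc))
  have lhs : ∫ z, gC z ∂ν = ((∫ z, g z ∂ν : ℝ) : ℂ) := integral_ofReal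
  apply_fun Complex.re at h
  rw [lhs, Complex.ofReal_re] at h
  rw [h, ← Complex.reCLM_apply (∫ z, gC z * fourierDensity c z ∂AddCircle.haarAddCircle),
    ← ContinuousLinearMap.integral_comp_comm _ hint]
  refine integral_congr_ae (ae_of_all _ fun z => ?_)
  simp [gC, fourierDensityRe, Complex.mul_re]

/-- The positive part `ρᵣ⁺ dz` of the candidate density as a measure. [folklore] -/
def densityPos (c : ℤ → ℂ) : Measure UnitAddCircle :=
  AddCircle.haarAddCircle.withDensity fun z => ENNReal.ofReal (fourierDensityRe c z)

/-- The negative part `ρᵣ⁻ dz` of the candidate density as a measure. [folklore] -/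
def densityNeg (c : ℤ → ℂ) : Measure UnitAddCircle :=
  AddCircle.haarAddCircle.withDensity fun z => ENNReal.ofReal (-fourierDensityRe c z)

/-- Measurability of `ρᵣ⁺`. [folklore] -/
theorem measurable_ofReal_fourierDensityRe (hc : Summable fun n => ‖c n‖) :
    Measurable fun z => ENNReal.ofReal (fourierDensityRe c z) :=
  ENNReal.measurable_ofReal.comp (continuous_fourierDensityRe hc).measurable

/-- Measurability of `ρᵣ⁻`. [folklore] -/
theorem measurable_ofReal_neg_fourierDensityRe (hc : Summable fun n => ‖c n‖) :
    Measurable fun z => ENNReal.ofReal (-fourierDensityRe c z) :=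
  ENNReal.measurable_ofReal.comp (continuous_fourierDensityRe hc).measurable.neg

/-- `ρᵣ⁺ dz` is a finite measure. [folklore] -/
theorem isFiniteMeasure_densityPos (hc : Summable fun n => ‖c n‖) :
    IsFiniteMeasure (densityPos c) := by
  unfold densityPos
  refine isFiniteMeasure_withDensity ((lintegral_mono (g := fun _ => ENNReal.ofReal
    (∑' n, ‖c n‖)) fun z => ?_).trans_lt (by simp)).ne
  exact ENNReal.ofReal_le_ofReal ((le_abs_self _).trans (abs_fourierDensityRe_le hc z))

/-- `ρᵣ⁻ dz` is a finite measure. [folklore] -/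
theorem isFiniteMeasure_densityNeg (hc : Summable fun n => ‖c n‖) :
    IsFiniteMeasure (densityNeg c) := by
  unfold densityNeg
  refine isFiniteMeasure_withDensity ((lintegral_mono (g := fun _ => ENNReal.ofReal
    (∑' n, ‖c n‖)) fun z => ?_).trans_lt (by simp)).ne
  exact ENNReal.ofReal_le_ofReal ((neg_le_abs _).trans (abs_fourierDensityRe_le hc z))

variable {E : Type*} [NormedAddCommGroup E] [NormedSpace ℝ E]

/-- Integration against `ρᵣ⁺ dz`. [folklore] -/
theorem integral_densityPos (hc : Summable fun n => ‖c n‖) (g : UnitAddCircle → E) :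
    ∫ z, g z ∂densityPos c = ∫ z, max (fourierDensityRe c z) 0 • g z ∂AddCircle.haarAddCircle := by
  unfold densityPos
  rw [integral_withDensity_eq_integral_toReal_smul (measurable_ofReal_fourierDensityRe hc)
    (ae_of_all _ fun z => ENNReal.ofReal_lt_top)]
  simp only [ENNReal.toReal_ofReal']

/-- Integration against `ρᵣ⁻ dz`. [folklore] -/
theorem integral_densityNeg (hc : Summable fun n => ‖c n‖) (g : UnitAddCircle → E) :
    ∫ z, g z ∂densityNeg c =
      ∫ z, max (-fourierDensityRe c z) 0 • g z ∂AddCircle.haarAddCircle := by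
  unfold densityNeg
  rw [integral_withDensity_eq_integral_toReal_smul (measurable_ofReal_neg_fourierDensityRe hc)
    (ae_of_all _ fun z => ENNReal.ofReal_lt_top)]
  simp only [ENNReal.toReal_ofReal']

/-- **Step 3.** As measures: `ν + ρᵣ⁻ dz = ρᵣ⁺ dz` (two finite Borel measures integrating all bounded
continuous functions equally). [folklore] -/
theorem measure_add_densityNeg_eq (hc : Summable fun n => ‖c n‖)
    (hν : ∀ n : ℤ, ∫ z, fourier (-n) z ∂ν = c n) : ν + densityNeg c = densityPos c := by
  haveI := isFiniteMeasure_densityPos hc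
  haveI := isFiniteMeasure_densityNeg hc
  apply ext_of_forall_integral_eq_of_IsFiniteMeasure
  intro g
  have h1 : Integrable (fun z => g z * fourierDensityRe c z) AddCircle.haarAddCircle :=
    (g.integrable _).mul_bdd (continuous_fourierDensityRe hc).aestronglyMeasurable
      (ae_of_all _ fun z => (Real.norm_eq_abs _).le.trans (abs_fourierDensityRe_le hc z))
  have h2 : Integrable (fun z => max (-fourierDensityRe c z) 0 • g z) AddCircle.haarAddCircle := by
    refine (g.integrable _).bdd_smul (∑' n, ‖c n‖)
      ((continuous_fourierDensityRe hc).neg.max continuous_const).aestronglyMeasurable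
      (ae_of_all _ fun z => ?_)
    rw [Real.norm_eq_abs, abs_of_nonneg (le_max_right _ _)]
    exact max_le ((neg_le_abs _).trans (abs_fourierDensityRe_le hc z))
      (tsum_nonneg fun n => norm_nonneg _)
  rw [integral_add_measure (g.integrable ν) (g.integrable _), integral_bcf_eq_of_fourierCoeff hc hν g,
    integral_densityPos hc, integral_densityNeg hc, ← integral_add h1 h2]
  refine integral_congr_ae (ae_of_all _ fun z => ?_)
  simp only [smul_eq_mul]
  have : fourierDensityRe c z + max (-fourierDensityRe c z) 0 = max (fourierDensityRe c z) 0 := by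
    rcases le_total 0 (fourierDensityRe c z) with h | h
    · rw [max_eq_right (by linarith), max_eq_left h]; ring
    · rw [max_eq_left (by linarith), max_eq_right h]; ring
  rw [← this]; ring

/-- **Step 4 (Fourier inversion for measures on the circle).** A finite Borel measure `ν` on
`𝕋 = ℝ/ℤ` whose Fourier coefficients `c(n) = ∫ e_{-n} dν` are absolutely summable integrates every
bounded Borel function `g` as `∫ g dν = ∫_𝕋 g(z) Re(∑ₙ c(n) e_n(z)) dz`; in particular `ν` is
absolutely continuous with the continuous density `Re ∑ c(n) e_n` (`= ∑ c(n) e_n`, which is real).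
[folklore] -/
theorem integral_eq_of_summable_fourierCoeff (hc : Summable fun n => ‖c n‖)
    (hν : ∀ n : ℤ, ∫ z, fourier (-n) z ∂ν = c n) {g : UnitAddCircle → ℝ} (hg : Measurable g)
    {M : ℝ} (hM : ∀ z, |g z| ≤ M) :
    ∫ z, g z ∂ν = ∫ z, g z * fourierDensityRe c z ∂AddCircle.haarAddCircle := by
  haveI := isFiniteMeasure_densityPos hc
  haveI := isFiniteMeasure_densityNeg hc
  have hgb : ∀ (μ : Measure UnitAddCircle) [IsFiniteMeasure μ], Integrable g μ := fun μ _ =>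
    .of_bound hg.aestronglyMeasurable M (ae_of_all _ fun z => by rw [Real.norm_eq_abs]; exact hM z)
  have h := integral_add_measure (hgb ν) (hgb (densityNeg c))
  rw [measure_add_densityNeg_eq hc hν, integral_densityPos hc, integral_densityNeg hc] at h
  have hb : ∀ z, ‖fourierDensityRe c z‖ ≤ ∑' n, ‖c n‖ := fun z =>
    (Real.norm_eq_abs _).le.trans (abs_fourierDensityRe_le hc z)
  have i3 : Integrable (fun z => max (fourierDensityRe c z) 0 • g z) AddCircle.haarAddCircle := by
    refine (hgb _).bdd_smul (∑' n, ‖c n‖)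
      ((continuous_fourierDensityRe hc).max continuous_const).aestronglyMeasurable
      (ae_of_all _ fun z => ?_)
    rw [Real.norm_eq_abs, abs_of_nonneg (le_max_right _ _)]
    exact max_le ((le_abs_self _).trans (abs_fourierDensityRe_le hc z))
      (tsum_nonneg fun n => norm_nonneg _)
  have i4 : Integrable (fun z => max (-fourierDensityRe c z) 0 • g z) AddCircle.haarAddCircle := by
    refine (hgb _).bdd_smul (∑' n, ‖c n‖)
      ((continuous_fourierDensityRe hc).neg.max continuous_const).aestronglyMeasurable
      (ae_of_all _ fun z => ?_)
    rw [Real.norm_eq_abs, abs_of_nonneg (le_max_right _ _)]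
    exact max_le ((neg_le_abs _).trans (abs_fourierDensityRe_le hc z))
      (tsum_nonneg fun n => norm_nonneg _)
  have h' : ∫ z, g z ∂ν = ∫ z, max (fourierDensityRe c z) 0 • g z ∂AddCircle.haarAddCircle -
      ∫ z, max (-fourierDensityRe c z) 0 • g z ∂AddCircle.haarAddCircle := by linarith
  rw [h', ← integral_sub i3 i4]
  refine integral_congr_ae (ae_of_all _ fun z => ?_)
  simp only [smul_eq_mul]
  have : max (fourierDensityRe c z) 0 - max (-fourierDensityRe c z) 0 = fourierDensityRe c z := by
    rcases le_total 0 (fourierDensityRe c z) with h | h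
    · rw [max_eq_left h, max_eq_right (by linarith)]; ring
    · rw [max_eq_right h, max_eq_left (by linarith)]; ring
  rw [← sub_mul, this, mul_comm]

end Circle

/-! ### From the circle to `1`-periodic functions on `ℝ` -/

section RealLine

variable {Ω : Type*} [MeasurableSpace Ω] {P : Measure Ω} [IsFiniteMeasure P] {Z : Ω → ℝ}
  {d : ℤ → ℂ} {u : ℝ → ℝ}

/-- The `n`-th Fourier coefficient `û(n) = ∫₀¹ u(s) e^{-2πins} ds` of a `1`-periodic function.
[folklore] -/
def circleCoeff (u : ℝ → ℝ) (n : ℤ) : ℂ :=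
  ∫ s in (0 : ℝ)..1, (u s : ℂ) * cexp (-(2 * π * I * n * s))

/-- The lift of a `1`-periodic Borel function to the circle is Borel. [folklore] -/
theorem measurable_periodic_lift (hu : Function.Periodic u 1) (hum : Measurable u) :
    Measurable hu.lift := by
  have : hu.lift = (u ∘ Subtype.val) ∘ (AddCircle.measurableEquivIco (1 : ℝ) 0) := by
    funext z
    simp only [Function.comp_apply]
    conv_lhs => rw [← AddCircle.coe_equivIco (p := (1 : ℝ)) (a := 0) (y := z)]
    exact hu.lift_coe _
  rw [this]
  exact (hum.comp measurable_subtype_coe).comp (AddCircle.measurableEquivIco 1 0).measurable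

/-- Characters evaluated on the lift of a real number. [folklore] -/
theorem fourier_coe_one (n : ℤ) (s : ℝ) :
    fourier n ((s : ℝ) : UnitAddCircle) = cexp (2 * π * I * n * s) := by
  rw [fourier_coe_apply, Complex.ofReal_one, div_one]

/-- **Fourier inversion for the law of a real random variable modulo `1`.** Let `Z` be a real
random variable on a finite measure space with `d(n) = 𝔼 e^{2πinZ}` absolutely summable over
`n ∈ ℤ`. Then for every bounded Borel `1`-periodic `u` and every `x ∈ ℝ`,
`𝔼 u(x + Z) = ∫₀¹ u(x + t) Re(∑ₙ d(n) e^{-2πint}) dt`. [folklore] -/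
theorem integral_comp_add_eq_intervalIntegral (hZ : Measurable Z)
    (hd : ∀ n : ℤ, ∫ ω, cexp (2 * π * I * n * Z ω) ∂P = d n) (hs : Summable fun n => ‖d n‖)
    (hu : Function.Periodic u 1) (hum : Measurable u) {M : ℝ} (hM : ∀ s, |u s| ≤ M) (x : ℝ) :
    ∫ ω, u (x + Z ω) ∂P =
      ∫ t in (0 : ℝ)..1, u (x + t) * (∑' n : ℤ, d n * cexp (-(2 * π * I * n * t))).re := by
  -- the law of `Z mod 1`
  set c : ℤ → ℂ := fun n => d (-n) with hc_def
  have hc : Summable fun n => ‖c n‖ := by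
    have := (Equiv.neg ℤ).summable_iff.mpr hs
    exact this
  have hZ' : Measurable fun ω => ((Z ω : ℝ) : UnitAddCircle) := AddCircle.measurable_mk'.comp hZ
  set ν : Measure UnitAddCircle := Measure.map (fun ω => ((Z ω : ℝ) : UnitAddCircle)) P with hν_def
  have hν : ∀ n : ℤ, ∫ z, fourier (-n) z ∂ν = c n := by
    intro n
    rw [hν_def, integral_map hZ'.aemeasurable (fourier (-n)).continuous.aestronglyMeasurable]
    simp only [fourier_coe_one, hc_def, ← hd (-n), Int.cast_neg]
  -- the test function
  set g : UnitAddCircle → ℝ := fun z => hu.lift ((x : UnitAddCircle) + z) with hg_def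
  have hgm : Measurable g := (measurable_periodic_lift hu hum).comp (measurable_const_add _)
  have hg_coe : ∀ s : ℝ, g (s : UnitAddCircle) = u (x + s) := fun s => by
    simp only [hg_def]
    rw [← QuotientAddGroup.mk_add]
    exact hu.lift_coe (x + s)
  have hgM : ∀ z, |g z| ≤ M := by
    intro z
    induction z using QuotientAddGroup.induction_on with
    | H s => rw [hg_coe]; exact hM _
  have key := integral_eq_of_summable_fourierCoeff hc hν hgm hgM
  -- left-hand side
  have lhs : ∫ z, g z ∂ν = ∫ ω, u (x + Z ω) ∂P := by
    rw [hν_def, integral_map hZ'.aemeasurable hgm.aestronglyMeasurable]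
    simp only [hg_coe]
  -- right-hand side
  have rhs : ∫ z, g z * fourierDensityRe c z ∂AddCircle.haarAddCircle =
      ∫ t in (0 : ℝ)..1, u (x + t) * (∑' n : ℤ, d n * cexp (-(2 * π * I * n * t))).re := by
    have hvol : (volume : Measure UnitAddCircle) = AddCircle.haarAddCircle := by
      rw [AddCircle.volume_eq_smul_haarAddCircle, ENNReal.ofReal_one, one_smul]
    rw [← hvol, ← UnitAddCircle.intervalIntegral_preimage 0, zero_add]
    refine intervalIntegral.integral_congr fun t _ => ?_
    simp only [hg_coe, fourierDensityRe, fourierDensity, hc_def, fourier_coe_one]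
    congr 2
    rw [← (Equiv.neg ℤ).tsum_eq]
    refine tsum_congr fun n => ?_
    simp only [Equiv.neg_apply, neg_neg, Int.cast_neg]
    congr 1
    congr 1
    ring
  rw [← lhs, key, rhs]

/-- `|û(n)| ≤ ∫₀¹ |u|`. [folklore] -/
theorem norm_circleCoeff_le (u : ℝ → ℝ) (n : ℤ) :
    ‖circleCoeff u n‖ ≤ ∫ s in (0 : ℝ)..1, |u s| := by
  unfold circleCoeff
  refine (intervalIntegral.norm_integral_le_integral_norm zero_le_one).trans (le_of_eq ?_)
  refine intervalIntegral.integral_congr fun s _ => ?_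
  simp only [norm_mul, Complex.norm_real, Real.norm_eq_abs, Complex.norm_exp]
  have : (-(2 * ↑π * I * ↑n * ↑s)).re = 0 := by
    simp [Complex.neg_re]
  rw [this, Real.exp_zero, mul_one]

/-- Shifting the window: `∫₀¹ u(x+t) e^{-2πint} dt = e^{2πinx} û(n)` for `1`-periodic `u`.
[folklore] -/
theorem intervalIntegral_comp_add_mul_cexp (hu : Function.Periodic u 1) (n : ℤ) (x : ℝ) :
    ∫ t in (0 : ℝ)..1, (u (x + t) : ℂ) * cexp (-(2 * π * I * n * t)) =
      cexp (2 * π * I * n * x) * circleCoeff u n := by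
  set H : ℝ → ℂ := fun s => (u s : ℂ) * cexp (-(2 * π * I * n * s)) * cexp (2 * π * I * n * x)
    with hH_def
  have hH : Function.Periodic H 1 := by
    intro s
    simp only [hH_def, hu s]
    congr 1
    rw [show -(2 * ↑π * I * ↑n * ((s + 1 : ℝ) : ℂ)) = -(2 * ↑π * I * ↑n * s) + (-n : ℤ) * (2 * π * I)
      by push_cast; ring, Complex.exp_add, Complex.exp_int_mul_two_pi_mul_I, mul_one]
  have h1 : (fun t => (u (x + t) : ℂ) * cexp (-(2 * π * I * n * t))) = fun t => H (x + t) := by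
    funext t
    simp only [hH_def]
    conv_rhs => rw [mul_assoc, ← Complex.exp_add]
    congr 1
    congr 1
    push_cast; ring
  rw [h1, intervalIntegral.integral_comp_add_left H x, add_zero, hH.intervalIntegral_add_eq x 0,
    zero_add]
  simp only [hH_def]
  rw [intervalIntegral.integral_mul_const, mul_comm]
  rfl

/-- Translating `u` multiplies `û(n)` by a phase: `(u(· + y))^(n) = e^{2πiny} û(n)`. [folklore] -/
theorem circleCoeff_comp_add (hu : Function.Periodic u 1) (y : ℝ) (n : ℤ) :
    circleCoeff (fun t => u (t + y)) n = cexp (2 * π * I * n * y) * circleCoeff u n := by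
  rw [← intervalIntegral_comp_add_mul_cexp hu n y]
  unfold circleCoeff
  refine intervalIntegral.integral_congr fun t _ => ?_
  simp only [add_comm t y]

/-- `|e^{-2πis} - 1| ≤ 2πr` when `s` is within `r` of an integer. [folklore] -/
theorem norm_cexp_sub_one_le_of_near_int {s r : ℝ} {k : ℤ} (h : |s - k| < r) (n : ℤ) :
    ‖cexp (-(2 * π * I * (n + 1) * s)) - cexp (-(2 * π * I * n * s))‖ ≤ 2 * π * r := by
  have h1 : cexp (-(2 * π * I * (n + 1) * s)) - cexp (-(2 * π * I * n * s)) =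
      cexp (-(2 * π * I * n * s)) * (cexp (I * ((-(2 * π * (s - k)) : ℝ) : ℂ)) - 1) := by
    rw [mul_sub, mul_one, ← Complex.exp_add]
    congr 1
    rw [show -(2 * ↑π * I * ↑n * ↑s) + I * ((-(2 * π * (s - k)) : ℝ) : ℂ) =
      -(2 * π * I * (n + 1) * s) + k * (2 * π * I) by push_cast; ring, Complex.exp_add,
      Complex.exp_int_mul_two_pi_mul_I, mul_one]
  rw [h1, norm_mul, Complex.norm_exp]
  have h2 : (-(2 * ↑π * I * ↑n * ↑s) : ℂ).re = 0 := by simp [Complex.neg_re]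
  rw [h2, Real.exp_zero, one_mul]
  refine (Real.norm_exp_I_mul_ofReal_sub_one_le).trans ?_
  rw [Real.norm_eq_abs, abs_neg, abs_mul, abs_of_pos (by positivity : (0 : ℝ) < 2 * π)]
  exact mul_le_mul_of_nonneg_left h.le (by positivity)

/-- Bounded Borel functions are interval integrable. [folklore] -/
theorem intervalIntegrable_of_norm_le {f : ℝ → ℂ} (hf : Measurable f) {C : ℝ}
    (hC : ∀ s, ‖f s‖ ≤ C) (a b : ℝ) : IntervalIntegrable f volume a b :=
  (intervalIntegrable_const (c := C)).mono_fun' hf.aestronglyMeasurable (ae_of_all _ hC)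

/-- Measurability of the Fourier integrand `v(s) e^{-2πins}`. [folklore] -/
theorem measurable_ofReal_mul_cexp {v : ℝ → ℝ} (hvm : Measurable v) (n : ℤ) :
    Measurable fun s : ℝ => (v s : ℂ) * cexp (-(2 * π * I * n * s)) :=
  (Complex.measurable_ofReal.comp hvm).mul (by fun_prop)

/-- `|v(s) e^{-2πins}| = |v(s)|`. [folklore] -/
theorem norm_ofReal_mul_cexp {v : ℝ → ℝ} (n : ℤ) (s : ℝ) :
    ‖(v s : ℂ) * cexp (-(2 * π * I * n * s))‖ = |v s| := by
  rw [norm_mul, Complex.norm_real, Real.norm_eq_abs, Complex.norm_exp]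
  have : (-(2 * ↑π * I * ↑n * ↑s) : ℂ).re = 0 := by simp [Complex.neg_re]
  rw [this, Real.exp_zero, mul_one]

/-- **First difference of Fourier coefficients of a function supported near `ℤ`**: if `v` vanishes
off `B(0, r) + ℤ` then `|v̂(n+1) - v̂(n)| ≤ 2πr ∫₀¹|v|`. [folklore] -/
theorem norm_circleCoeff_succ_sub_le {v : ℝ → ℝ} (hvm : Measurable v) {M : ℝ}
    (hM : ∀ s, |v s| ≤ M) {r : ℝ} (hv : ∀ s, v s ≠ 0 → ∃ k : ℤ, |s - k| < r) (n : ℤ) :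
    ‖circleCoeff v (n + 1) - circleCoeff v n‖ ≤ 2 * π * r * ∫ s in (0 : ℝ)..1, |v s| := by
  have hi : ∀ m : ℤ, IntervalIntegrable (fun s : ℝ => (v s : ℂ) * cexp (-(2 * π * I * m * s)))
      volume 0 1 := fun m =>
    intervalIntegrable_of_norm_le (measurable_ofReal_mul_cexp hvm m)
      (fun s => by rw [norm_ofReal_mul_cexp]; exact hM s) 0 1
  have hiv : IntervalIntegrable (fun s => |v s|) volume 0 1 :=
    (intervalIntegrable_const (c := M)).mono_fun'
      (continuous_abs.measurable.comp hvm).aestronglyMeasurable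
      (ae_of_all _ fun s => by simp only [Real.norm_eq_abs, abs_abs]; exact hM s)
  have hpt : ∀ s, ‖(v s : ℂ) * cexp (-(2 * π * I * ((n + 1 : ℤ) : ℂ) * s)) -
      (v s : ℂ) * cexp (-(2 * π * I * n * s))‖ ≤ 2 * π * r * |v s| := by
    intro s
    by_cases hs : v s = 0
    · simp [hs]
    · obtain ⟨k, hk⟩ := hv s hs
      rw [← mul_sub, norm_mul, Complex.norm_real, Real.norm_eq_abs, Int.cast_add, Int.cast_one]
      calc |v s| * ‖cexp (-(2 * π * I * (n + 1) * s)) - cexp (-(2 * π * I * n * s))‖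
          ≤ |v s| * (2 * π * r) :=
            mul_le_mul_of_nonneg_left (norm_cexp_sub_one_le_of_near_int hk n) (abs_nonneg _)
        _ = 2 * π * r * |v s| := by ring
  unfold circleCoeff
  rw [← intervalIntegral.integral_sub (hi (n + 1)) (hi n), ← intervalIntegral.integral_const_mul]
  refine (intervalIntegral.norm_integral_le_integral_norm zero_le_one).trans
    (intervalIntegral.integral_mono_on zero_le_one ((hi (n + 1)).sub (hi n)).norm
      (hiv.const_mul _) fun s _ => hpt s)

/-- **Second difference of Fourier coefficients of a function supported near `ℤ`**: if `v`
vanishes off `B(0, r) + ℤ` then `|v̂(n+2) - 2v̂(n+1) + v̂(n)| ≤ (2πr)² ∫₀¹|v|`. [folklore] -/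
theorem norm_circleCoeff_second_diff_le {v : ℝ → ℝ} (hvm : Measurable v) {M : ℝ}
    (hM : ∀ s, |v s| ≤ M) {r : ℝ} (hv : ∀ s, v s ≠ 0 → ∃ k : ℤ, |s - k| < r) (n : ℤ) :
    ‖circleCoeff v (n + 2) - 2 * circleCoeff v (n + 1) + circleCoeff v n‖ ≤
      (2 * π * r) ^ 2 * ∫ s in (0 : ℝ)..1, |v s| := by
  have hi : ∀ m : ℤ, IntervalIntegrable (fun s : ℝ => (v s : ℂ) * cexp (-(2 * π * I * m * s)))
      volume 0 1 := fun m =>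
    intervalIntegrable_of_norm_le (measurable_ofReal_mul_cexp hvm m)
      (fun s => by rw [norm_ofReal_mul_cexp]; exact hM s) 0 1
  have hiv : IntervalIntegrable (fun s => |v s|) volume 0 1 :=
    (intervalIntegrable_const (c := M)).mono_fun'
      (continuous_abs.measurable.comp hvm).aestronglyMeasurable
      (ae_of_all _ fun s => by simp only [Real.norm_eq_abs, abs_abs]; exact hM s)
  -- pointwise: the integrand is `v(s) e^{-2πins} (w - 1)²`, `w = e^{-2πis}`
  have hpt : ∀ s, ‖(v s : ℂ) * cexp (-(2 * π * I * ((n + 2 : ℤ) : ℂ) * s)) -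
      2 * ((v s : ℂ) * cexp (-(2 * π * I * ((n + 1 : ℤ) : ℂ) * s))) +
      (v s : ℂ) * cexp (-(2 * π * I * n * s))‖ ≤ (2 * π * r) ^ 2 * |v s| := by
    intro s
    by_cases hs : v s = 0
    · simp [hs]
    · obtain ⟨k, hk⟩ := hv s hs
      have hw : ‖cexp (-(2 * π * I * s)) - 1‖ ≤ 2 * π * r := by
        simpa using norm_cexp_sub_one_le_of_near_int hk 0
      have h2 : cexp (-(2 * π * I * ((n + 2 : ℤ) : ℂ) * s)) =
          cexp (-(2 * π * I * n * s)) * cexp (-(2 * π * I * s)) ^ 2 := by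
        rw [sq, ← Complex.exp_add, ← Complex.exp_add]; congr 1; push_cast; ring
      have h1 : cexp (-(2 * π * I * ((n + 1 : ℤ) : ℂ) * s)) =
          cexp (-(2 * π * I * n * s)) * cexp (-(2 * π * I * s)) := by
        rw [← Complex.exp_add]; congr 1; push_cast; ring
      rw [h2, h1, show (v s : ℂ) * (cexp (-(2 * π * I * n * s)) * cexp (-(2 * π * I * s)) ^ 2) -
        2 * ((v s : ℂ) * (cexp (-(2 * π * I * n * s)) * cexp (-(2 * π * I * s)))) +
        (v s : ℂ) * cexp (-(2 * π * I * n * s)) =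
        ((v s : ℂ) * cexp (-(2 * π * I * n * s))) * (cexp (-(2 * π * I * s)) - 1) ^ 2 by ring,
        norm_mul, norm_ofReal_mul_cexp, norm_pow]
      calc |v s| * ‖cexp (-(2 * π * I * s)) - 1‖ ^ 2 ≤ |v s| * (2 * π * r) ^ 2 := by
            gcongr
        _ = (2 * π * r) ^ 2 * |v s| := by ring
  unfold circleCoeff
  rw [← intervalIntegral.integral_const_mul (2 : ℂ), ← intervalIntegral.integral_sub (hi (n + 2))
    ((hi (n + 1)).const_mul _), ← intervalIntegral.integral_add ((hi (n + 2)).sub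
    ((hi (n + 1)).const_mul _)) (hi n), ← intervalIntegral.integral_const_mul]
  exact (intervalIntegral.norm_integral_le_integral_norm zero_le_one).trans
    (intervalIntegral.integral_mono_on zero_le_one (((hi (n + 2)).sub
      ((hi (n + 1)).const_mul _)).add (hi n)).norm (hiv.const_mul _) fun s _ => hpt s)

/-- **Fourier inversion for the law of a real random variable modulo `1`, series form.** With
`d(n) = 𝔼 e^{2πinZ}` absolutely summable, `𝔼 u(x + Z) = Re ∑ₙ d(n) û(n) e^{2πinx}` for every
bounded Borel `1`-periodic `u` and every `x ∈ ℝ` — an everywhere (not a.e.) identity. [folklore] -/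
theorem integral_comp_add_eq_re_tsum (hZ : Measurable Z)
    (hd : ∀ n : ℤ, ∫ ω, cexp (2 * π * I * n * Z ω) ∂P = d n) (hs : Summable fun n => ‖d n‖)
    (hu : Function.Periodic u 1) (hum : Measurable u) {M : ℝ} (hM : ∀ s, |u s| ≤ M) (x : ℝ) :
    ∫ ω, u (x + Z ω) ∂P =
      (∑' n : ℤ, d n * circleCoeff u n * cexp (2 * π * I * n * x)).re := by
  rw [integral_comp_add_eq_intervalIntegral hZ hd hs hu hum hM x]
  have hM0 : 0 ≤ M := (abs_nonneg _).trans (hM 0)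
  -- the terms and their integrability on `(0, 1]`
  set F : ℤ → ℝ → ℂ := fun n t => (u (x + t) : ℂ) * (d n * cexp (-(2 * π * I * n * t))) with hF
  have hFm : ∀ n, AEStronglyMeasurable (F n) (volume.restrict (Ioc 0 1)) := fun n => by
    simp only [hF]
    refine (Measurable.aestronglyMeasurable ?_)
    exact (Complex.measurable_ofReal.comp (hum.comp (measurable_const_add x))).mul
      (measurable_const.mul (by fun_prop))
  have hFb : ∀ n t, ‖F n t‖ ≤ M * ‖d n‖ := fun n t => by
    simp only [hF, norm_mul, Complex.norm_real, Real.norm_eq_abs, Complex.norm_exp]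
    have : (-(2 * ↑π * I * ↑n * ↑t)).re = 0 := by simp [Complex.neg_re]
    rw [this, Real.exp_zero, mul_one]
    exact mul_le_mul_of_nonneg_right (hM _) (norm_nonneg _)
  haveI : IsFiniteMeasure (volume.restrict (Ioc (0 : ℝ) 1)) := by
    refine ⟨by simp⟩
  have hFi : ∀ n, Integrable (F n) (volume.restrict (Ioc 0 1)) := fun n =>
    .of_bound (hFm n) _ (ae_of_all _ (hFb n))
  have hFs : Summable fun n => ∫ t, ‖F n t‖ ∂(volume.restrict (Ioc 0 1)) := by
    refine .of_nonneg_of_le (fun n => integral_nonneg fun t => norm_nonneg _) (fun n => ?_)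
      (hs.mul_left M)
    calc ∫ t, ‖F n t‖ ∂(volume.restrict (Ioc 0 1)) ≤ ∫ _t, M * ‖d n‖ ∂(volume.restrict (Ioc 0 1)) :=
          integral_mono_of_nonneg (ae_of_all _ fun t => norm_nonneg _) (integrable_const _)
            (ae_of_all _ (hFb n))
      _ = M * ‖d n‖ := by simp
  -- real part outside
  have step1 : ∫ t in (0 : ℝ)..1, u (x + t) * (∑' n : ℤ, d n * cexp (-(2 * π * I * n * t))).re =
      (∫ t in (0 : ℝ)..1, ∑' n, F n t).re := by
    rw [intervalIntegral.integral_of_le zero_le_one, intervalIntegral.integral_of_le zero_le_one,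
      ← Complex.reCLM_apply (∫ t in Ioc 0 1, ∑' n, F n t), ← ContinuousLinearMap.integral_comp_comm]
    · refine integral_congr_ae (ae_of_all _ fun t => ?_)
      simp only [hF, Complex.reCLM_apply]
      rw [tsum_mul_left, Complex.re_ofReal_mul]
    · simp only [hF]
      simp_rw [tsum_mul_left]
      refine .of_bound ?_ (M * ∑' n, ‖d n‖) (ae_of_all _ fun t => ?_)
      · exact (Complex.measurable_ofReal.comp (hum.comp (measurable_const_add x))).aestronglyMeasurable.mul
          (continuous_tsum (fun n => by fun_prop) hs (fun n t => by
            simp only [norm_mul, Complex.norm_exp]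
            have : (-(2 * ↑π * I * ↑n * ↑t)).re = 0 := by simp [Complex.neg_re]
            rw [this, Real.exp_zero, mul_one])).aestronglyMeasurable
      · rw [norm_mul, Complex.norm_real, Real.norm_eq_abs]
        refine mul_le_mul (hM _) (tsum_of_norm_bounded hs.hasSum fun n => ?_) (norm_nonneg _) hM0
        simp only [norm_mul, Complex.norm_exp]
        have : (-(2 * ↑π * I * ↑n * ↑t)).re = 0 := by simp [Complex.neg_re]
        rw [this, Real.exp_zero, mul_one]
  rw [step1, intervalIntegral.integral_of_le zero_le_one,
    ← integral_tsum_of_summable_integral_norm hFi hFs]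
  congr 1
  refine tsum_congr fun n => ?_
  simp only [hF]
  rw [← intervalIntegral.integral_of_le zero_le_one]
  calc ∫ t in (0 : ℝ)..1, (u (x + t) : ℂ) * (d n * cexp (-(2 * π * I * n * t)))
      = d n * ∫ t in (0 : ℝ)..1, (u (x + t) : ℂ) * cexp (-(2 * π * I * n * t)) := by
        rw [← intervalIntegral.integral_const_mul]
        refine intervalIntegral.integral_congr fun t _ => ?_
        ring
    _ = d n * circleCoeff u n * cexp (2 * π * I * n * x) := by
        rw [intervalIntegral_comp_add_mul_cexp hu n x]; ring

end RealLine

/-! ### Absolutely convergent trigonometric series: two derivatives and the `sin`-weights -/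

section TrigSeries

/-- The trigonometric series `F_a(θ) = ∑_ξ a(ξ) e^{2πiξθ}` of an absolutely summable sequence.
[folklore] -/
def trigSeries (a : ℤ → ℂ) (θ : ℝ) : ℂ := ∑' ξ : ℤ, a ξ * cexp (2 * π * I * ξ * θ)

/-- The coefficient sequence of the termwise derivative: `(2πiξ) a(ξ)`. [folklore] -/
def derivCoeff (a : ℤ → ℂ) (ξ : ℤ) : ℂ := 2 * π * I * ξ * a ξ

/-- The forward difference `a(ξ+1) - a(ξ)` of a coefficient sequence. [folklore] -/
def fwdDiff (a : ℤ → ℂ) (ξ : ℤ) : ℂ := a (ξ + 1) - a ξ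

variable {a : ℤ → ℂ}

/-- `|e^{2πiξθ}| = 1`. [folklore] -/
theorem norm_cexp_two_pi_mul (ξ : ℤ) (θ : ℝ) : ‖cexp (2 * π * I * ξ * θ)‖ = 1 := by
  rw [Complex.norm_exp]
  have : (2 * ↑π * I * ↑ξ * ↑θ : ℂ).re = 0 := by simp
  rw [this, Real.exp_zero]

/-- Each term of `F_a` is bounded by `|a(ξ)|`. [folklore] -/
theorem norm_term_le (a : ℤ → ℂ) (ξ : ℤ) (θ : ℝ) : ‖a ξ * cexp (2 * π * I * ξ * θ)‖ ≤ ‖a ξ‖ := by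
  rw [norm_mul, norm_cexp_two_pi_mul, mul_one]

/-- The terms of `F_a(θ)` are summable. [folklore] -/
theorem summable_trigSeries_terms (ha : Summable fun ξ => ‖a ξ‖) (θ : ℝ) :
    Summable fun ξ => a ξ * cexp (2 * π * I * ξ * θ) :=
  .of_norm_bounded ha fun ξ => norm_term_le a ξ θ

/-- `|F_a(θ)| ≤ ∑ |a(ξ)|`. [folklore] -/
theorem norm_trigSeries_le (ha : Summable fun ξ => ‖a ξ‖) (θ : ℝ) :
    ‖trigSeries a θ‖ ≤ ∑' ξ, ‖a ξ‖ :=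
  tsum_of_norm_bounded ha.hasSum fun ξ => norm_term_le a ξ θ

/-- `F_a` is continuous. [folklore] -/
theorem continuous_trigSeries (ha : Summable fun ξ => ‖a ξ‖) : Continuous (trigSeries a) := by
  unfold trigSeries
  exact continuous_tsum (fun ξ => by fun_prop) ha fun ξ θ => norm_term_le a ξ θ

/-- `d/dθ e^{2πiξθ} = 2πiξ e^{2πiξθ}`. [folklore] -/
theorem hasDerivAt_cexp_two_pi_mul (ξ : ℤ) (θ : ℝ) :
    HasDerivAt (fun θ : ℝ => cexp (2 * π * I * ξ * θ))
      (2 * π * I * ξ * cexp (2 * π * I * ξ * θ)) θ := by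
  have h1 : HasDerivAt (fun θ : ℝ => (2 * π * I * ξ * θ : ℂ)) (2 * π * I * ξ) θ := by
    simpa using (hasDerivAt_id (θ : ℂ)).comp_ofReal.const_mul (2 * π * I * ξ : ℂ)
  simpa [mul_comm] using h1.cexp

/-- Termwise differentiation: `F_a' = F_{(2πiξ)a}` when `∑ |ξ a(ξ)| < ∞`. [folklore] -/
theorem hasDerivAt_trigSeries (ha : Summable fun ξ => ‖a ξ‖)
    (ha₁ : Summable fun ξ => ‖derivCoeff a ξ‖) (θ : ℝ) :
    HasDerivAt (trigSeries a) (trigSeries (derivCoeff a) θ) θ := by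
  unfold trigSeries
  have h := hasDerivAt_tsum (u := fun ξ => ‖derivCoeff a ξ‖) ha₁
    (g := fun ξ (θ : ℝ) => a ξ * cexp (2 * π * I * ξ * θ))
    (g' := fun ξ (θ : ℝ) => derivCoeff a ξ * cexp (2 * π * I * ξ * θ))
    (fun ξ θ => by
      have := (hasDerivAt_cexp_two_pi_mul ξ θ).const_mul (a ξ)
      exact this.congr_deriv (by simp only [derivCoeff]; ring))
    (fun ξ θ => norm_term_le _ ξ θ) (summable_trigSeries_terms ha 0) θ
  exact h

/-- `F_a' = F_{(2πiξ)a}` as functions. [folklore] -/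
theorem deriv_trigSeries (ha : Summable fun ξ => ‖a ξ‖)
    (ha₁ : Summable fun ξ => ‖derivCoeff a ξ‖) :
    deriv (trigSeries a) = trigSeries (derivCoeff a) :=
  funext fun θ => (hasDerivAt_trigSeries ha ha₁ θ).deriv

/-- `F_a ∈ C²` with `F_a' = F_{(2πiξ)a}`, `F_a'' = F_{(2πiξ)²a}` when `∑ ξ²|a(ξ)| < ∞`. [folklore] -/
theorem contDiff_two_trigSeries (ha : Summable fun ξ => ‖a ξ‖)
    (ha₁ : Summable fun ξ => ‖derivCoeff a ξ‖)
    (ha₂ : Summable fun ξ => ‖derivCoeff (derivCoeff a) ξ‖) : ContDiff ℝ 2 (trigSeries a) := by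
  rw [show (2 : WithTop ℕ∞) = 1 + 1 from rfl, contDiff_succ_iff_deriv, deriv_trigSeries ha ha₁,
    contDiff_one_iff_deriv, deriv_trigSeries ha₁ ha₂]
  refine ⟨fun θ => (hasDerivAt_trigSeries ha ha₁ θ).differentiableAt, by simp, fun θ =>
    (hasDerivAt_trigSeries ha₁ ha₂ θ).differentiableAt, continuous_trigSeries ha₂⟩

/-- `F_a'' = F_{(2πiξ)²a}` as functions. [folklore] -/
theorem iteratedDeriv_two_trigSeries (ha : Summable fun ξ => ‖a ξ‖)
    (ha₁ : Summable fun ξ => ‖derivCoeff a ξ‖)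
    (ha₂ : Summable fun ξ => ‖derivCoeff (derivCoeff a) ξ‖) :
    iteratedDeriv 2 (trigSeries a) = trigSeries (derivCoeff (derivCoeff a)) := by
  rw [iteratedDeriv_succ, iteratedDeriv_one, deriv_trigSeries ha ha₁, deriv_trigSeries ha₁ ha₂]

/-- The real trigonometric sum `G(x) = Re F_a(x + c₀)` has derivative `Re F_{(2πiξ)a}(x + c₀)`.
[folklore] -/
theorem hasDerivAt_re_trigSeries (ha : Summable fun ξ => ‖a ξ‖)
    (ha₁ : Summable fun ξ => ‖derivCoeff a ξ‖) (c₀ x : ℝ) :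
    HasDerivAt (fun x : ℝ => (trigSeries a (x + c₀)).re)
      (trigSeries (derivCoeff a) (x + c₀)).re x := by
  have h := (hasDerivAt_trigSeries ha ha₁ (x + c₀)).comp_add_const x c₀
  exact Complex.reCLM.hasFDerivAt.comp_hasDerivAt x h

/-- `G' = Re F_{(2πiξ)a}(· + c₀)` as functions. [folklore] -/
theorem deriv_re_trigSeries (ha : Summable fun ξ => ‖a ξ‖)
    (ha₁ : Summable fun ξ => ‖derivCoeff a ξ‖) (c₀ : ℝ) :
    deriv (fun x : ℝ => (trigSeries a (x + c₀)).re) =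
      fun x => (trigSeries (derivCoeff a) (x + c₀)).re :=
  funext fun x => (hasDerivAt_re_trigSeries ha ha₁ c₀ x).deriv

/-- `G'' = Re F_{(2πiξ)²a}(· + c₀)` as functions. [folklore] -/
theorem iteratedDeriv_two_re_trigSeries (ha : Summable fun ξ => ‖a ξ‖)
    (ha₁ : Summable fun ξ => ‖derivCoeff a ξ‖)
    (ha₂ : Summable fun ξ => ‖derivCoeff (derivCoeff a) ξ‖) (c₀ : ℝ) :
    iteratedDeriv 2 (fun x : ℝ => (trigSeries a (x + c₀)).re) =
      fun x => (trigSeries (derivCoeff (derivCoeff a)) (x + c₀)).re := by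
  rw [iteratedDeriv_succ, iteratedDeriv_one, deriv_re_trigSeries ha ha₁, deriv_re_trigSeries ha₁ ha₂]

/-- `x ↦ Re F_a(x + c₀)` is `C²` when `∑ ξ²|a(ξ)| < ∞`. [folklore] -/
theorem contDiff_two_re_trigSeries (ha : Summable fun ξ => ‖a ξ‖)
    (ha₁ : Summable fun ξ => ‖derivCoeff a ξ‖)
    (ha₂ : Summable fun ξ => ‖derivCoeff (derivCoeff a) ξ‖) (c₀ : ℝ) :
    ContDiff ℝ 2 fun x : ℝ => (trigSeries a (x + c₀)).re :=
  Complex.reCLM.contDiff.comp ((contDiff_two_trigSeries ha ha₁ ha₂).comp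
    (contDiff_id.add contDiff_const))

/-- **The `sin`-weight identity**: `sin(πθ) F_a(θ) = (e^{iπθ}/2i) F_{-Δa}(θ)`, `Δa(ξ) = a(ξ+1) - a(ξ)`
(multiplying by `sin πθ = (e^{iπθ} - e^{-iπθ})/2i` shifts the frequencies by `±½`). [folklore] -/
theorem sin_mul_trigSeries (ha : Summable fun ξ => ‖a ξ‖) (θ : ℝ) :
    (Real.sin (π * θ) : ℂ) * trigSeries a θ =
      -(cexp (π * I * θ) / (2 * I)) * trigSeries (fwdDiff a) θ := by
  have hsum := summable_trigSeries_terms ha θ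
  have ha' : Summable fun ξ => ‖a (ξ + 1)‖ := (Equiv.addRight (1 : ℤ)).summable_iff.mpr ha
  have hsum' : Summable fun ξ => a (ξ + 1) * cexp (2 * π * I * ξ * θ) :=
    .of_norm_bounded ha' fun ξ => by rw [norm_mul, norm_cexp_two_pi_mul, mul_one]
  -- `e^{2πi(ξ+1)θ} = e^{2πiξθ} e^{2πiθ}`
  have hexp : ∀ ξ : ℤ, cexp (2 * π * I * ((ξ + 1 : ℤ) : ℂ) * θ) =
      cexp (2 * π * I * ξ * θ) * cexp (2 * π * I * θ) := fun ξ => by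
    rw [← Complex.exp_add]; congr 1; push_cast; ring
  -- shift the summation index in `∑ a(ξ) e_ξ = ∑ a(ξ+1) e_{ξ+1}`
  have hshift : trigSeries a θ = cexp (2 * π * I * θ) * ∑' ξ : ℤ, a (ξ + 1) * cexp (2 * π * I * ξ * θ) := by
    unfold trigSeries
    rw [← (Equiv.addRight (1 : ℤ)).tsum_eq, ← tsum_mul_left]
    refine tsum_congr fun ξ => ?_
    simp only [Equiv.coe_addRight, hexp]
    ring
  have hI : (2 : ℂ) * I ≠ 0 := by simp
  have hsin : (Real.sin (π * θ) : ℂ) = (cexp (π * I * θ) - cexp (-(π * I * θ))) / (2 * I) := by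
    rw [Complex.ofReal_sin, Complex.sin]
    have e1 : -((π * θ : ℝ) : ℂ) * I = -(π * I * θ) := by push_cast; ring
    have e2 : ((π * θ : ℝ) : ℂ) * I = π * I * θ := by push_cast; ring
    rw [e1, e2, eq_div_iff hI]
    linear_combination (cexp (-(↑π * I * ↑θ)) - cexp (↑π * I * ↑θ)) * Complex.I_sq
  -- assemble
  unfold trigSeries fwdDiff
  rw [show (∑' ξ : ℤ, (a (ξ + 1) - a ξ) * cexp (2 * π * I * ξ * θ)) =
      (∑' ξ : ℤ, a (ξ + 1) * cexp (2 * π * I * ξ * θ)) - ∑' ξ : ℤ, a ξ * cexp (2 * π * I * ξ * θ) by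
    rw [← hsum'.tsum_sub hsum]; exact tsum_congr fun ξ => by ring]
  have h2 : ∑' ξ : ℤ, a ξ * cexp (2 * π * I * ξ * θ) =
      cexp (2 * π * I * θ) * ∑' ξ : ℤ, a (ξ + 1) * cexp (2 * π * I * ξ * θ) := hshift
  have hee : cexp (2 * π * I * θ) = cexp (π * I * θ) * cexp (π * I * θ) := by
    rw [← Complex.exp_add]; congr 1; ring
  have hinv : cexp (-(π * I * θ)) * cexp (π * I * θ) = 1 := by
    rw [← Complex.exp_add, neg_add_cancel, Complex.exp_zero]
  rw [h2, hsin, hee]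
  simp only [div_eq_mul_inv]
  linear_combination (-((2 * I)⁻¹ * (∑' ξ : ℤ, a (ξ + 1) * cexp (2 * π * I * ξ * θ)) *
    cexp (π * I * θ))) * hinv

/-- `|e^{iπθ}/2i| = ½`. [folklore] -/
theorem norm_cexp_div_two_I (θ : ℝ) : ‖-(cexp (π * I * θ) / (2 * I))‖ = 1 / 2 := by
  rw [norm_neg, norm_div, Complex.norm_exp]
  have : (↑π * I * ↑θ : ℂ).re = 0 := by simp
  rw [this, Real.exp_zero]
  simp

/-- **First `sin`-weight bound**: `|sin(πθ) F_a(θ)| ≤ ½ ∑_ξ |a(ξ+1) - a(ξ)|`. [folklore] -/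
theorem norm_sin_mul_trigSeries_le (ha : Summable fun ξ => ‖a ξ‖)
    (hΔ : Summable fun ξ => ‖fwdDiff a ξ‖) (θ : ℝ) :
    ‖(Real.sin (π * θ) : ℂ) * trigSeries a θ‖ ≤ 1 / 2 * ∑' ξ, ‖fwdDiff a ξ‖ := by
  rw [sin_mul_trigSeries ha, norm_mul, norm_cexp_div_two_I]
  exact mul_le_mul_of_nonneg_left (norm_trigSeries_le hΔ θ) (by norm_num)

/-- **Second `sin`-weight bound**: `|sin²(πθ) F_a(θ)| ≤ ¼ ∑_ξ |a(ξ+2) - 2a(ξ+1) + a(ξ)|`. [folklore] -/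
theorem norm_sin_sq_mul_trigSeries_le (ha : Summable fun ξ => ‖a ξ‖)
    (hΔ : Summable fun ξ => ‖fwdDiff a ξ‖) (hΔ₂ : Summable fun ξ => ‖fwdDiff (fwdDiff a) ξ‖)
    (θ : ℝ) :
    ‖(Real.sin (π * θ) : ℂ) ^ 2 * trigSeries a θ‖ ≤ 1 / 4 * ∑' ξ, ‖fwdDiff (fwdDiff a) ξ‖ := by
  rw [sq, mul_assoc, sin_mul_trigSeries ha, mul_left_comm, sin_mul_trigSeries hΔ, norm_mul,
    norm_mul, norm_cexp_div_two_I]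
  calc 1 / 2 * (1 / 2 * ‖trigSeries (fwdDiff (fwdDiff a)) θ‖)
      ≤ 1 / 2 * (1 / 2 * ∑' ξ, ‖fwdDiff (fwdDiff a) ξ‖) := by
        gcongr; exact norm_trigSeries_le hΔ₂ θ
    _ = 1 / 4 * ∑' ξ, ‖fwdDiff (fwdDiff a) ξ‖ := by ring

end TrigSeries

end Literature.Barriers.AtomisticToContinuum.HeatConduction
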